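import Summits.Ventures.PercRepro.SixFourT3B

/-!
# PercRepro — C-025 at `(6,4)`, LEMMA 22.1 IN THE KERNEL: the structural identity for `J₄` (p3, gen 8)

mine-2's `MINE2-RLS.md` §22.1 (the first piece of THEOREM 22, the `t = 4` closing of `(6,4)`): for every rank-`4`
set `G ⊆ E` of a simple matroid, with `g = |G|`, `p = |ρ ∩ G|` for a plane `ρ`, `m = |ℓ ∩ G|` for a line `ℓ`,
`D₃(ρ) = #{S ⊆ ρ ∩ G : |S| ≥ 4, r(S) = 3}`, `r₃(ρ,4) = #{S ⊆ ρ ∩ G : |S| = 4, r(S) = 3}`,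
`S₃(n) = 1 + n + C(n,2) + C(n,3)`, `δ(m) = 2^m − S₃(m)` and `X = #{Z ⊆ G : r(Z) ≤ 3, r(G ∖ Z) ≤ 3}`:

  `J₄ = F(g) − Σ_ρ cost_g(ρ) + Σ_ℓ bonus(m_ℓ) + (2/3)·lpp − (6/5)·X`,
  `F(g) = (4/5)·2^g + (2/5)·S₃(g) − (8/5)·C(g,4)`, `cost_g(ρ) = (g − p − 2/5)·D₃(ρ) − (8/5)·r₃(ρ,4)`,
  `bonus(m) = (2/5)·δ(m) + (8/5)·C(m,4)`

(`J_four_identity`).  The proof is mine-2's: from `J_four_eq`, `N₄ + T₃ = 2^g` (`N4_add_T3`), `DF₄ + X = T₃`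
(`DF_four_add_X`: complementation), `T₃ = S₃ + Σ_ρ D₃ + Σ_ℓ δ` (`T3_eq`: a rank-`≤ 3` set with `≥ 4` points lies in
a unique plane or a unique line), `I₄ + Σ_ρ r₃(ρ,4) + Σ_ℓ C(m,4) = C(g,4)` (`I4_eq`) and
`pp + 2·lpp = Σ_ρ (g − p)·D₃(ρ)` (`pp_add_two_lpp_eq`, from `sum_mTr_eq_sum_offCl`).  Sums over `planes M` /
`lines M` (every plane / line of `M`; traces with `≤ 3` points contribute `0`).
-/

namespace PercRepro.SixFour

open Finset ThmH

variable {α : Type*} [DecidableEq α] {M : Matroid α} [M.Finite] {G : Finset α}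

/-! ## The quantities of §22.0 -/

/-- `S₃(n) = 1 + n + C(n,2) + C(n,3)`: the subsets with at most `3` elements of an `n`-set. -/
def S3 (n : ℕ) : ℕ := 1 + n + n.choose 2 + n.choose 3

/-- `δ(m) = 2^m − S₃(m)`: the subsets with at least `4` elements of an `m`-set. -/
def delta (m : ℕ) : ℕ := 2 ^ m - S3 m

/-- `T₃(G)`: the subsets of `G` of rank at most `3`. -/
noncomputable def T3cnt (M : Matroid α) [M.Finite] (G : Finset α) : ℕ :=
  (G.powerset.filter (fun Z : Finset α => M.eRk (Z : Set α) ≤ 3)).card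

/-- `X(G)`: the subsets of rank at most `3` whose complement in `G` also has rank at most `3`. -/
noncomputable def Xcnt (M : Matroid α) [M.Finite] (G : Finset α) : ℕ :=
  (G.powerset.filter (fun Z : Finset α => M.eRk (Z : Set α) ≤ 3 ∧ M.eRk ((G \ Z : Finset α) : Set α) ≤ 3)).card

/-- `D₃(ρ)`: the rank-`3` subsets with at least `4` points of the trace `ρ ∩ G`. -/
noncomputable def D3 (M : Matroid α) [M.Finite] (G P : Finset α) : ℕ :=
  ((P ∩ G).powerset.filter (fun S : Finset α => 4 ≤ S.card ∧ M.eRk (S : Set α) = 3)).card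

/-- `r₃(ρ, 4)`: the rank-`3` `4`-subsets of the trace `ρ ∩ G`. -/
noncomputable def r34 (M : Matroid α) [M.Finite] (G P : Finset α) : ℕ :=
  (((P ∩ G).powersetCard 4).filter (fun S : Finset α => M.eRk (S : Set α) = 3)).card

/-- `F(g) = (4/5)·2^g + (2/5)·S₃(g) − (8/5)·C(g,4)`. -/
def Fg (g : ℕ) : ℚ := 4 / 5 * (2 : ℚ) ^ g + 2 / 5 * (S3 g : ℚ) - 8 / 5 * (g.choose 4 : ℚ)

/-- `cost_g(ρ) = (g − p − 2/5)·D₃(ρ) − (8/5)·r₃(ρ,4)`. -/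
noncomputable def cost (M : Matroid α) [M.Finite] (G P : Finset α) : ℚ :=
  ((G.card : ℚ) - (P ∩ G).card - 2 / 5) * (D3 M G P : ℚ) - 8 / 5 * (r34 M G P : ℚ)

/-- `bonus(m) = (2/5)·δ(m) + (8/5)·C(m,4)`. -/
def bonus (m : ℕ) : ℚ := 2 / 5 * (delta m : ℚ) + 8 / 5 * (m.choose 4 : ℚ)

/-! ## Subsets with at most `3` / at least `4` elements -/

omit [DecidableEq α] in
/-- The subsets with at most `3` elements of an `n`-set number `S₃(n)`. -/
theorem card_powerset_filter_card_le_three (T : Finset α) :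
    (T.powerset.filter (fun Z : Finset α => Z.card ≤ 3)).card = S3 T.card := by
  rw [Finset.powerset_card_disjiUnion, Finset.filter_disjiUnion, Finset.card_disjiUnion]
  have hterm : ∀ i ∈ Finset.range (T.card + 1),
      ((T.powersetCard i).filter (fun Z : Finset α => Z.card ≤ 3)).card = if i ≤ 3 then T.card.choose i else 0 := by
    intro i _
    split_ifs with hi
    · rw [Finset.filter_true_of_mem, Finset.card_powersetCard]
      intro Z hZ
      rw [(Finset.mem_powersetCard.1 hZ).2]
      exact hi
    · rw [Finset.card_eq_zero, Finset.filter_false_of_mem]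
      intro Z hZ
      rw [(Finset.mem_powersetCard.1 hZ).2]
      exact hi
  rw [Finset.sum_congr rfl hterm, ← Finset.sum_filter]
  have hsub : (Finset.range (T.card + 1)).filter (fun i => i ≤ 3) ⊆ Finset.range 4 := by
    intro i hi
    rw [Finset.mem_filter] at hi
    rw [Finset.mem_range]
    omega
  rw [Finset.sum_subset hsub (fun i hi hni => ?_)]
  · simp only [Finset.sum_range_succ, Finset.sum_range_zero, Nat.choose_zero_right, Nat.choose_one_right]
    unfold S3
    ring
  · rw [Finset.mem_range] at hi
    rw [Finset.mem_filter, Finset.mem_range, not_and] at hni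
    have : T.card < i := by
      by_contra h
      exact hni (by omega) (by omega)
    exact Nat.choose_eq_zero_of_lt this

omit [DecidableEq α] in
/-- The subsets with at least `4` elements of an `m`-set number `δ(m)`. -/
theorem card_powerset_filter_four_le (T : Finset α) :
    (T.powerset.filter (fun Z : Finset α => 4 ≤ Z.card)).card = delta T.card := by
  have h := Finset.card_filter_add_card_filter_not (s := T.powerset) (fun Z : Finset α => Z.card ≤ 3)
  rw [card_powerset_filter_card_le_three, Finset.card_powerset] at h
  have hcongr : T.powerset.filter (fun Z : Finset α => ¬ Z.card ≤ 3) =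
      T.powerset.filter (fun Z : Finset α => 4 ≤ Z.card) :=
    Finset.filter_congr (fun Z _ => by omega)
  rw [hcongr] at h
  unfold delta
  omega

/-! ## `N₄ + T₃ = 2^g` and `DF₄ + X = T₃` -/

omit [DecidableEq α] in
/-- For `B ⊆ G` with `r(G) = 4`: `r(B) ≤ 3 ↔ r(B) ≠ 4`. -/
theorem eRk_le_three_iff_ne_four' (hr : M.eRk (G : Set α) = 4) {B : Finset α} (hB : B ⊆ G) :
    M.eRk (B : Set α) ≤ 3 ↔ ¬ M.eRk (B : Set α) = 4 := by
  have hle : M.eRk (B : Set α) ≤ 4 := by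
    rw [← hr]
    exact M.eRk_mono (Finset.coe_subset.2 hB)
  constructor
  · intro h3 h4
    rw [h4] at h3
    exact absurd h3 (by decide)
  · intro h4
    by_contra h3
    exact h4 (eRk_eq_of_le_of_not_le (n := 3) hle h3)

omit [DecidableEq α] in
/-- `N₄ + T₃ = 2^g`. -/
theorem N4_add_T3 (hr : M.eRk (G : Set α) = 4) : N4 M G + T3cnt M G = 2 ^ G.card := by
  unfold N4 R4 T3cnt
  have hcongr : G.powerset.filter (fun Z : Finset α => M.eRk (Z : Set α) ≤ 3) =
      G.powerset.filter (fun Z : Finset α => ¬ M.eRk (Z : Set α) = 4) :=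
    Finset.filter_congr (fun Z hZ => eRk_le_three_iff_ne_four' hr (Finset.mem_powerset.1 hZ))
  rw [hcongr, Finset.card_filter_add_card_filter_not, Finset.card_powerset]

/-- `DF₄ + X = T₃`: `B′ ↦ G ∖ B′` maps the demand-free sets at `t = 4` onto the rank-`≤ 3` sets whose complement
has rank `4`. -/
theorem DF_four_add_X (hr : M.eRk (G : Set α) = 4) : DF M G 4 + Xcnt M G = T3cnt M G := by
  have hsplit := Finset.card_filter_add_card_filter_not
    (s := G.powerset.filter (fun Z : Finset α => M.eRk (Z : Set α) ≤ 3))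
    (fun Z : Finset α => M.eRk ((G \ Z : Finset α) : Set α) ≤ 3)
  rw [Finset.filter_filter, Finset.filter_filter] at hsplit
  have hX : Xcnt M G = (G.powerset.filter (fun Z : Finset α => M.eRk (Z : Set α) ≤ 3 ∧
      M.eRk ((G \ Z : Finset α) : Set α) ≤ 3)).card := rfl
  unfold T3cnt
  rw [← hsplit, ← hX, add_comm]
  congr 1
  -- `DF₄ = #{Z : r(Z) ≤ 3 ∧ ¬ r(G ∖ Z) ≤ 3}` via `B ↦ G ∖ B`
  unfold DF
  refine Finset.card_nbij' (fun B => G \ B) (fun Z => G \ Z) ?_ ?_ ?_ ?_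
  · intro B hB
    rw [Finset.coe_filter] at hB
    obtain ⟨hB4, hdf⟩ := hB
    obtain ⟨hBG, hB4⟩ := mem_R4.1 hB4
    rw [Finset.mem_coe, Finset.mem_filter, Finset.mem_powerset]
    refine ⟨Finset.sdiff_subset, ?_, ?_⟩
    · have : M.eRk ((G \ B : Finset α) : Set α) + 1 ≤ ((4 : ℕ) : ℕ∞) := hdf
      obtain ⟨k, hk, -⟩ := eRk_eq_nat M (G \ B)
      rw [hk] at this ⊢
      have h1 : k + 1 ≤ 4 := by exact_mod_cast this
      exact_mod_cast (by omega : k ≤ 3)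
    · rw [Finset.sdiff_sdiff_eq_self hBG, hB4]
      decide
  · intro Z hZ
    rw [Finset.mem_coe, Finset.mem_filter, Finset.mem_powerset] at hZ
    obtain ⟨hZG, hZ3, hZc⟩ := hZ
    rw [Finset.mem_coe, Finset.mem_filter, mem_R4]
    refine ⟨⟨Finset.sdiff_subset, ?_⟩, ?_⟩
    · have hle : M.eRk ((G \ Z : Finset α) : Set α) ≤ 4 := by
        rw [← hr]; exact M.eRk_mono (Finset.coe_subset.2 Finset.sdiff_subset)
      exact eRk_eq_of_le_of_not_le (n := 3) hle hZc
    · rw [Finset.sdiff_sdiff_eq_self hZG]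
      obtain ⟨k, hk, -⟩ := eRk_eq_nat M Z
      rw [hk] at hZ3 ⊢
      have h3 : k ≤ 3 := by exact_mod_cast hZ3
      exact_mod_cast (by omega : k + 1 ≤ 4)
  · intro B hB
    rw [Finset.coe_filter] at hB
    exact Finset.sdiff_sdiff_eq_self (mem_R4.1 hB.1).1
  · intro Z hZ
    rw [Finset.mem_coe, Finset.mem_filter, Finset.mem_powerset] at hZ
    exact Finset.sdiff_sdiff_eq_self hZ.1

end PercRepro.SixFour
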